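import Mathlib.Data.Finset.SymmDiff
import Mathlib.MeasureTheory.Integral.Bochner.Basic
import Summits.CriticalPhenomena.Ising3DConformalLimit.Theorems.HyperoctahedralRPExistsScaleCovariantLimitBlockCovAlgebra
import Summits.CriticalPhenomena.Ising3DConformalLimit.Theorems.HyperoctahedralRPExistsScaleCovariantLimitBlockMomentBounded
import Literature.Probability.LatticeModels.CriticalBlockMoments
import HarnessLib

/-!
# Stub E3 `stub_logContinuity` of line `Sketch` for crux `JoiningsTransfer` (stmt-CriticalPhenomena-18764)

Route `SynchronousCoupling`, sub-problem `CriticalPhenomena/Ising3DConformalLimit`, crux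
`Summit.CriticalPhenomena.Ising3DConformalLimit.Theses.SynchronousCoupling.JoiningsTransfer`, line `Sketch`
(skeleton `Cruxes/JoiningsTransfer/Lines/Sketch.lean`). This file proves the registered stub
`stub_logContinuity` (E3): the normalised block moments `R_n(L; k⃗) = critBlockMoment n L k` are asymptotically
continuous in `log L` — for `L ≤ L' ≤ (1+s)L` large, `|R_n(L'; k⃗) − R_n(L; k⃗)| ≤ ε` — GIVEN (verbatim, as
hypotheses) the moment-difference inequality (stub B), the block model (stub C: a probability measure `μ` computing
`criticalCorr` and `critBlockMoment` as integrals of normalised block spins `X_L(u) = V(L)^{-1/2} Σ_{cube L} σ_{x+Lu}`,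
`V(L) = blockCov L 0`) and the slab-variance bound (stub E2: the two-point mass of the symmetric difference of the
blocks at sides `L ≤ L' ≤ (1+s)L` is `≤ ε₁ V(L)`).

Mechanism (elementary): with `B, B'` the two block sums and `D = B' − B` (a `±1`-signed spin sum over the symmetric
difference), `∫ B² = V(L) ≤ V(L') = ∫ B'²`, `∫ D² ≤ ε₁ V(L)` (expansion into two-point functions), and Peter–Paul
`∫ (pf + qg)² ≤ (1+θ⁻¹)p² ∫f² + (1+θ)q² ∫g²` gives `V(L') ≤ (1+√ε₁)² V(L)` and then `∫ (X_{L'}(u) − X_L(u))² ≤ 4ε₁`;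
the moment-difference inequality with the uniform `2(n−1)`-moment bound (landed `stub_blockMomentBounded`) gives
`|ΔR_n| ≤ n √(4ε₁) √M ≤ ε`. Sources: crux idea card `Cruxes/JoiningsTransfer/Ideas/towers-to-all-scales-croft.md`;
block vocabulary `Theorems/HyperoctahedralRPExistsScaleCovariantLimitBlockDefs.lean`. No new definitions.
-/

noncomputable section

namespace Summit.CriticalPhenomena.Ising3DConformalLimit.Cruxes.JoiningsTransfer.Sketch

open Literature.Probability.LatticeModels MeasureTheory Filter Set
open scoped Topology BigOperators
open Summit.CriticalPhenomena.Ising3DConformalLimit.Cruxes.ExistsScaleCovariantLimit.MonotoneBlockingPort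

/-! ## Two elementary real-variable estimates and Peter–Paul in `L²` -/

/-- `(1 + θ⁻¹) I + (1 + θ) V ≤ (1 + θ)² V` when `I ≤ θ² V`, `θ > 0`. [folklore] -/
private theorem real_amgm_bound {V I θ : ℝ} (hθ : 0 < θ) (hI : I ≤ θ ^ 2 * V) :
    (1 + θ⁻¹) * 1 ^ 2 * I + (1 + θ) * 1 ^ 2 * V ≤ (1 + θ) ^ 2 * V := by
  have hθne : θ ≠ 0 := hθ.ne'
  have h1 : (1 + θ⁻¹) * I ≤ (1 + θ⁻¹) * (θ ^ 2 * V) := mul_le_mul_of_nonneg_left hI (by positivity)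
  have e : (1 + θ⁻¹) * (θ ^ 2 * V) = (θ ^ 2 + θ) * V := by
    field_simp
  simp only [one_pow, mul_one]
  nlinarith [h1, e]

/-- The endgame: with `a = √V ≤ b = √V' ≤ (1+θ) a` and `I ≤ θ² V`,
`2 b⁻² I + 2 (b⁻¹ − a⁻¹)² V ≤ 4 θ²`. [folklore] -/
private theorem real_endgame {V V' I θ : ℝ} (hV : 0 < V) (hVV' : V ≤ V') (hθ : 0 < θ)
    (hV'le : V' ≤ (1 + θ) ^ 2 * V) (hI : I ≤ θ ^ 2 * V) :
    (1 + (1 : ℝ)⁻¹) * (Real.sqrt V')⁻¹ ^ 2 * I + (1 + 1) * ((Real.sqrt V')⁻¹ - (Real.sqrt V)⁻¹) ^ 2 * V ≤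
      4 * θ ^ 2 := by
  have hV' : 0 < V' := hV.trans_le hVV'
  have hba : Real.sqrt V' ≤ (1 + θ) * Real.sqrt V := by
    rw [← Real.sqrt_sq (by positivity : (0 : ℝ) ≤ 1 + θ), ← Real.sqrt_mul (sq_nonneg _)]
    exact Real.sqrt_le_sqrt hV'le
  have hab : Real.sqrt V ≤ Real.sqrt V' := Real.sqrt_le_sqrt hVV'
  have ha2 : Real.sqrt V ^ 2 = V := Real.sq_sqrt hV.le
  set a := Real.sqrt V with hadef
  set b := Real.sqrt V' with hbdef
  have ha : 0 < a := Real.sqrt_pos.2 hV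
  have hb : 0 < b := Real.sqrt_pos.2 hV'
  have hane : a ≠ 0 := ha.ne'
  have hbne : b ≠ 0 := hb.ne'
  have hr0 : 0 < a / b := div_pos ha hb
  have hr1 : a / b ≤ 1 := (div_le_one hb).2 hab
  have hr2 : 1 ≤ (1 + θ) * (a / b) := by
    rw [← mul_div_assoc, le_div_iff₀ hb, one_mul]
    exact hba
  have hI' : b⁻¹ ^ 2 * I ≤ θ ^ 2 * (a / b) ^ 2 := by
    rw [← ha2] at hI
    calc b⁻¹ ^ 2 * I ≤ b⁻¹ ^ 2 * (θ ^ 2 * a ^ 2) := mul_le_mul_of_nonneg_left hI (by positivity)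
      _ = θ ^ 2 * (a / b) ^ 2 := by rw [div_pow, inv_pow]; ring
  have e : (b⁻¹ - a⁻¹) ^ 2 * V = (1 - a / b) ^ 2 := by
    rw [← ha2]
    field_simp
    ring
  have h1 : θ ^ 2 * (a / b) ^ 2 ≤ θ ^ 2 := by
    have := pow_le_one₀ (n := 2) hr0.le hr1
    nlinarith [sq_nonneg θ]
  have h4 : 1 - a / b ≤ θ := by
    have : θ * (a / b) ≤ θ := mul_le_of_le_one_right hθ.le hr1
    nlinarith
  have h3 : 0 ≤ 1 - a / b := by linarith
  have h2 : (1 - a / b) ^ 2 ≤ θ ^ 2 := pow_le_pow_left₀ h3 h4 2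
  calc (1 + (1 : ℝ)⁻¹) * b⁻¹ ^ 2 * I + (1 + 1) * (b⁻¹ - a⁻¹) ^ 2 * V
      = 2 * (b⁻¹ ^ 2 * I) + 2 * ((b⁻¹ - a⁻¹) ^ 2 * V) := by norm_num; ring
    _ ≤ 2 * θ ^ 2 + 2 * θ ^ 2 := by rw [e]; linarith
    _ = 4 * θ ^ 2 := by ring

/-- Peter–Paul in `L²`: `∫ (p f + q g)² ≤ (1 + θ⁻¹) p² ∫ f² + (1 + θ) q² ∫ g²` for `θ > 0` and square-integrable
`f, g`. [folklore] -/
private theorem integral_add_sq_le {Ω : Type*} [MeasurableSpace Ω] {μ : Measure Ω} {f g : Ω → ℝ}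
    (hf : Integrable (fun ω => f ω ^ 2) μ) (hg : Integrable (fun ω => g ω ^ 2) μ) (p q : ℝ) {θ : ℝ}
    (hθ : 0 < θ) :
    ∫ ω, (p * f ω + q * g ω) ^ 2 ∂μ ≤
      (1 + θ⁻¹) * p ^ 2 * ∫ ω, f ω ^ 2 ∂μ + (1 + θ) * q ^ 2 * ∫ ω, g ω ^ 2 ∂μ := by
  have hθne : θ ≠ 0 := hθ.ne'
  have hpt : ∀ ω, (p * f ω + q * g ω) ^ 2 ≤ (1 + θ⁻¹) * p ^ 2 * f ω ^ 2 + (1 + θ) * q ^ 2 * g ω ^ 2 := by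
    intro ω
    have key : 0 ≤ θ⁻¹ * (p * f ω - θ * (q * g ω)) ^ 2 := by positivity
    have e : (1 + θ⁻¹) * p ^ 2 * f ω ^ 2 + (1 + θ) * q ^ 2 * g ω ^ 2 - (p * f ω + q * g ω) ^ 2 =
        θ⁻¹ * (p * f ω - θ * (q * g ω)) ^ 2 := by
      field_simp
      ring
    linarith
  calc ∫ ω, (p * f ω + q * g ω) ^ 2 ∂μ
      ≤ ∫ ω, ((1 + θ⁻¹) * p ^ 2 * f ω ^ 2 + (1 + θ) * q ^ 2 * g ω ^ 2) ∂μ :=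
        integral_mono_of_nonneg (Eventually.of_forall fun ω => sq_nonneg _)
          ((hf.const_mul _).add (hg.const_mul _)) (Eventually.of_forall hpt)
    _ = (1 + θ⁻¹) * p ^ 2 * ∫ ω, f ω ^ 2 ∂μ + (1 + θ) * q ^ 2 * ∫ ω, g ω ^ 2 ∂μ := by
        rw [integral_add (hf.const_mul _) (hg.const_mul _), integral_const_mul, integral_const_mul]

/-! ## Signed spin sums: integrability and second moments against a measure with the critical correlations -/

/-- A bounded measurable real function on spin configurations is integrable (finite measure). [folklore] -/
private theorem integrable_of_abs_le {μ : Measure (SpinConfig (Site 3))} [IsFiniteMeasure μ]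
    {f : SpinConfig (Site 3) → ℝ} (hf : Measurable f) (C : ℝ) (hC : ∀ σ, |f σ| ≤ C) :
    Integrable f μ :=
  Integrable.of_bound hf.aestronglyMeasurable C
    (Eventually.of_forall fun σ => by rw [Real.norm_eq_abs]; exact hC σ)

/-- The signs `±1` attached to a finset are bounded by `1`. [folklore] -/
private theorem abs_sign_le (Q' : Finset (Site 3)) :
    ∀ x : Site 3, |(if x ∈ Q' then (1 : ℝ) else -1)| ≤ 1 := fun x => by split_ifs <;> simp

/-- The square of a signed spin sum `Σ_{x ∈ S} e_x σ_x` with `|e_x| ≤ 1` is integrable. [folklore] -/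
private theorem integrable_signedSum_sq {μ : Measure (SpinConfig (Site 3))} [IsFiniteMeasure μ]
    (S : Finset (Site 3)) {e : Site 3 → ℝ} (he : ∀ x, |e x| ≤ 1) :
    Integrable (fun σ : SpinConfig (Site 3) => (∑ x ∈ S, e x * spinAt x σ) ^ 2) μ := by
  refine integrable_of_abs_le
    ((Finset.measurable_sum S fun x _ => (measurable_spinAt x).const_mul (e x)).pow_const 2)
    ((S.card : ℝ) ^ 2) fun σ => ?_
  rw [abs_pow]
  refine pow_le_pow_left₀ (abs_nonneg _) ?_ 2
  calc |∑ x ∈ S, e x * spinAt x σ| ≤ ∑ x ∈ S, |e x * spinAt x σ| := Finset.abs_sum_le_sum_abs _ _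
    _ ≤ ∑ x ∈ S, (1 : ℝ) := Finset.sum_le_sum fun x _ => by
        rw [abs_mul, abs_spinAt, mul_one]; exact he x
    _ = S.card := by simp

/-- The square of a plain spin sum `Σ_{x ∈ Q} σ_x` is integrable. [folklore] -/
private theorem integrable_spinSum_sq {μ : Measure (SpinConfig (Site 3))} [IsFiniteMeasure μ]
    (Q : Finset (Site 3)) : Integrable (fun σ : SpinConfig (Site 3) => (∑ x ∈ Q, spinAt x σ) ^ 2) μ := by
  simpa using integrable_signedSum_sq (μ := μ) Q (e := fun _ => (1 : ℝ)) (fun _ => by simp)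

/-- `∫ σ_x σ_y dμ = ⟨σ₀ σ_{y-x}⟩_{β_c}` for a measure computing the critical correlations. [folklore] -/
private theorem integral_spinAt_mul_spinAt {μ : Measure (SpinConfig (Site 3))}
    (hcorr : ∀ (n : ℕ) (y : Fin n → Site 3), criticalCorr 3 n y = ∫ σ, spinMonomial y σ ∂μ)
    (x y : Site 3) : ∫ σ, spinAt x σ * spinAt y σ ∂μ = criticalTwoPoint 3 (y - x) := by
  rw [← criticalCorr_two_pair, hcorr 2 ![x, y]]
  congr 1
  funext σ
  simp [spinMonomial, Fin.prod_univ_two]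

/-- `∫ (Σ_{x ∈ S} e_x σ_x)² dμ = Σ_{x,y ∈ S} e_x e_y ⟨σ₀σ_{y-x}⟩_{β_c}`. [folklore] -/
private theorem integral_signedSum_sq {μ : Measure (SpinConfig (Site 3))} [IsFiniteMeasure μ]
    (hcorr : ∀ (n : ℕ) (y : Fin n → Site 3), criticalCorr 3 n y = ∫ σ, spinMonomial y σ ∂μ)
    (S : Finset (Site 3)) (e : Site 3 → ℝ) :
    ∫ σ, (∑ x ∈ S, e x * spinAt x σ) ^ 2 ∂μ =
      ∑ x ∈ S, ∑ y ∈ S, e x * e y * criticalTwoPoint 3 (y - x) := by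
  have hpt : ∀ σ : SpinConfig (Site 3), (∑ x ∈ S, e x * spinAt x σ) ^ 2 =
      ∑ x ∈ S, ∑ y ∈ S, e x * e y * (spinAt x σ * spinAt y σ) := by
    intro σ
    rw [sq, Finset.sum_mul_sum]
    refine Finset.sum_congr rfl fun x _ => Finset.sum_congr rfl fun y _ => ?_
    ring
  have hint : ∀ x y : Site 3,
      Integrable (fun σ : SpinConfig (Site 3) => e x * e y * (spinAt x σ * spinAt y σ)) μ := by
    intro x y
    refine integrable_of_abs_le (((measurable_spinAt x).mul (measurable_spinAt y)).const_mul _)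
      (|e x * e y|) fun σ => ?_
    rw [abs_mul (e x * e y), abs_mul (spinAt x σ), abs_spinAt, abs_spinAt, mul_one, mul_one]
  simp_rw [hpt]
  rw [integral_finsetSum _ fun x _ => integrable_finsetSum _ fun y _ => hint x y]
  refine Finset.sum_congr rfl fun x _ => ?_
  rw [integral_finsetSum _ fun y _ => hint x y]
  refine Finset.sum_congr rfl fun y _ => ?_
  rw [integral_const_mul, integral_spinAt_mul_spinAt hcorr]

/-- `∫ (Σ_{x ∈ S} e_x σ_x)² dμ ≤ Σ_{x,y ∈ S} ⟨σ₀σ_{y-x}⟩_{β_c}` when `|e_x| ≤ 1` (Griffiths: `⟨σ₀σ_v⟩ ≥ 0`).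
[folklore] -/
private theorem integral_signedSum_sq_le {μ : Measure (SpinConfig (Site 3))} [IsFiniteMeasure μ]
    (hcorr : ∀ (n : ℕ) (y : Fin n → Site 3), criticalCorr 3 n y = ∫ σ, spinMonomial y σ ∂μ)
    (S : Finset (Site 3)) {e : Site 3 → ℝ} (he : ∀ x, |e x| ≤ 1) :
    ∫ σ, (∑ x ∈ S, e x * spinAt x σ) ^ 2 ∂μ ≤ ∑ x ∈ S, ∑ y ∈ S, criticalTwoPoint 3 (y - x) := by
  rw [integral_signedSum_sq hcorr S e]
  refine Finset.sum_le_sum fun x _ => Finset.sum_le_sum fun y _ => ?_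
  have hG := criticalTwoPoint_nonneg' (d := 3) (y - x)
  have h1 : e x * e y ≤ 1 := by
    calc e x * e y ≤ |e x * e y| := le_abs_self _
      _ = |e x| * |e y| := abs_mul _ _
      _ ≤ 1 * 1 := mul_le_mul (he x) (he y) (abs_nonneg _) zero_le_one
      _ = 1 := one_mul 1
  nlinarith

/-- `∫ (Σ_{x ∈ Q} σ_x)² dμ = Σ_{x,y ∈ Q} ⟨σ₀σ_{y-x}⟩_{β_c}`. [folklore] -/
private theorem integral_spinSum_sq {μ : Measure (SpinConfig (Site 3))} [IsFiniteMeasure μ]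
    (hcorr : ∀ (n : ℕ) (y : Fin n → Site 3), criticalCorr 3 n y = ∫ σ, spinMonomial y σ ∂μ)
    (Q : Finset (Site 3)) :
    ∫ σ, (∑ x ∈ Q, spinAt x σ) ^ 2 ∂μ = ∑ x ∈ Q, ∑ y ∈ Q, criticalTwoPoint 3 (y - x) := by
  simpa using integral_signedSum_sq hcorr Q (fun _ => (1 : ℝ))

/-- Translation is injective on any finset of sites. [folklore] -/
private theorem injOn_add_const (S : Finset (Site 3)) (v : Site 3) :
    Set.InjOn (fun x : Site 3 => x + v) (S : Set (Site 3)) := fun _ _ _ _ h => add_right_cancel h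

/-- `∫ (Σ_{x ∈ cube L + Lu} σ_x)² dμ = V(L)`: the second moment of a shifted block sum is the block variance
(expansion into two-point functions, `⟨σ_xσ_y⟩_{β_c} = ⟨σ₀σ_{y-x}⟩_{β_c}`). [folklore] -/
private theorem integral_shiftedBlockSum_sq {μ : Measure (SpinConfig (Site 3))} [IsFiniteMeasure μ]
    (hcorr : ∀ (n : ℕ) (y : Fin n → Site 3), criticalCorr 3 n y = ∫ σ, spinMonomial y σ ∂μ)
    (L : ℕ) (u : Site 3) :
    ∫ σ, (∑ x ∈ (cube L).image (fun x => x + (L : ℤ) • u), spinAt x σ) ^ 2 ∂μ = blockCov L 0 := by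
  have hinj := injOn_add_const (cube L) ((L : ℤ) • u)
  rw [integral_spinSum_sq hcorr, blockCov_zero_eq, Finset.sum_image hinj]
  refine Finset.sum_congr rfl fun x _ => ?_
  rw [Finset.sum_image hinj]
  refine Finset.sum_congr rfl fun y _ => ?_
  simp [add_sub_add_right_eq_sub]

/-- The difference of two spin sums is a `±1`-signed spin sum over the symmetric difference of the index sets.
[folklore] -/
private theorem sum_sub_sum_eq_signedSum (Q' Q : Finset (Site 3)) (σ : SpinConfig (Site 3)) :
    ∑ x ∈ Q', spinAt x σ - ∑ x ∈ Q, spinAt x σ =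
      ∑ x ∈ symmDiff Q' Q, (if x ∈ Q' then (1 : ℝ) else -1) * spinAt x σ := by
  rw [Finset.symmDiff_def, Finset.sum_union disjoint_sdiff_sdiff, ← Finset.sum_sdiff_sub_sum_sdiff,
    sub_eq_add_neg]
  congr 1
  · refine Finset.sum_congr rfl fun x hx => ?_
    rw [if_pos (Finset.mem_sdiff.1 hx).1, one_mul]
  · rw [← Finset.sum_neg_distrib]
    refine Finset.sum_congr rfl fun x hx => ?_
    rw [if_neg (Finset.mem_sdiff.1 hx).2, neg_one_mul]

/-! ## The `L²` increment of the normalised block spin -/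

/-- Core of the `L²` increment, for two arbitrary finsets `Q, Q'` of sites with `∫ (Σ_Q σ)² = V`,
`∫ (Σ_{Q'} σ)² = V'`, `0 < V ≤ V'` and two-point mass of `Q' ∆ Q` at most `θ² V`:
`∫ (V'^{-1/2} Σ_{Q'} σ − V^{-1/2} Σ_Q σ)² ≤ 4 θ²`. [folklore] -/
private theorem increment_core {μ : Measure (SpinConfig (Site 3))} [IsFiniteMeasure μ]
    (hcorr : ∀ (n : ℕ) (y : Fin n → Site 3), criticalCorr 3 n y = ∫ σ, spinMonomial y σ ∂μ)
    (Q Q' : Finset (Site 3)) {V V' θ : ℝ} (hV : 0 < V) (hVV' : V ≤ V') (hθ : 0 < θ)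
    (hQ : ∫ σ, (∑ x ∈ Q, spinAt x σ) ^ 2 ∂μ = V) (hQ' : ∫ σ, (∑ x ∈ Q', spinAt x σ) ^ 2 ∂μ = V')
    (hD : ∑ x ∈ symmDiff Q' Q, ∑ y ∈ symmDiff Q' Q, criticalTwoPoint 3 (y - x) ≤ θ ^ 2 * V) :
    ∫ σ, ((Real.sqrt V')⁻¹ * ∑ x ∈ Q', spinAt x σ - (Real.sqrt V)⁻¹ * ∑ x ∈ Q, spinAt x σ) ^ 2 ∂μ ≤
      4 * θ ^ 2 := by
  have hiQ : Integrable (fun σ : SpinConfig (Site 3) => (∑ x ∈ Q, spinAt x σ) ^ 2) μ :=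
    integrable_spinSum_sq Q
  have hiD : Integrable (fun σ : SpinConfig (Site 3) => (∑ x ∈ Q', spinAt x σ - ∑ x ∈ Q, spinAt x σ) ^ 2) μ := by
    simp_rw [sum_sub_sum_eq_signedSum]
    exact integrable_signedSum_sq _ (abs_sign_le Q')
  have hD2 : ∫ σ, (∑ x ∈ Q', spinAt x σ - ∑ x ∈ Q, spinAt x σ) ^ 2 ∂μ ≤ θ ^ 2 * V := by
    simp_rw [sum_sub_sum_eq_signedSum]
    exact (integral_signedSum_sq_le hcorr _ (abs_sign_le Q')).trans hD
  clear hD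
  -- `V' ≤ (1 + θ)² V` by Peter–Paul
  have hV'le : V' ≤ (1 + θ) ^ 2 * V := by
    have h := integral_add_sq_le hiD hiQ 1 1 hθ
    have e : ∀ σ : SpinConfig (Site 3),
        1 * (∑ x ∈ Q', spinAt x σ - ∑ x ∈ Q, spinAt x σ) + 1 * ∑ x ∈ Q, spinAt x σ =
          ∑ x ∈ Q', spinAt x σ := fun σ => by ring
    simp_rw [e] at h
    rw [hQ', hQ] at h
    exact h.trans (real_amgm_bound hθ hD2)
  -- the increment, again by Peter–Paul (with `θ = 1`)
  have e2 : ∀ σ : SpinConfig (Site 3),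
      (Real.sqrt V')⁻¹ * ∑ x ∈ Q', spinAt x σ - (Real.sqrt V)⁻¹ * ∑ x ∈ Q, spinAt x σ =
        (Real.sqrt V')⁻¹ * (∑ x ∈ Q', spinAt x σ - ∑ x ∈ Q, spinAt x σ) +
          ((Real.sqrt V')⁻¹ - (Real.sqrt V)⁻¹) * ∑ x ∈ Q, spinAt x σ := fun σ => by ring
  simp_rw [e2]
  refine (integral_add_sq_le hiD hiQ _ _ one_pos).trans ?_
  rw [hQ]
  exact real_endgame hV hVV' hθ hV'le hD2

/-- **The `L²` increment.** For `1 ≤ L ≤ L'` and `ε₁ > 0`, if the two-point mass of the symmetric difference of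
the shifted blocks `cube L' + L'u`, `cube L + Lu` is `≤ ε₁ V(L)`, then the normalised block spins
`X_L(u) = V(L)^{-1/2} Σ_{x ∈ cube L} σ_{x + Lu}` satisfy `∫ (X_{L'}(u) − X_L(u))² dμ ≤ 4 ε₁`. [folklore] -/
theorem stub_logContinuity_increment {μ : Measure (SpinConfig (Site 3))} [IsFiniteMeasure μ]
    (hcorr : ∀ (n : ℕ) (y : Fin n → Site 3), criticalCorr 3 n y = ∫ σ, spinMonomial y σ ∂μ)
    {L L' : ℕ} (hL : 1 ≤ L) (hLL' : L ≤ L') (u : Site 3) {ε₁ : ℝ} (hε₁ : 0 < ε₁)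
    (hD : ∑ x ∈ symmDiff ((cube L').image (fun x => x + (L' : ℤ) • u))
        ((cube L).image (fun x => x + (L : ℤ) • u)),
      ∑ y ∈ symmDiff ((cube L').image (fun x => x + (L' : ℤ) • u))
        ((cube L).image (fun x => x + (L : ℤ) • u)), criticalTwoPoint 3 (y - x) ≤ ε₁ * blockCov L 0) :
    ∫ σ, ((Real.sqrt (blockCov L' 0))⁻¹ * ∑ x ∈ cube L', spinAt (x + (L' : ℤ) • u) σ -
        (Real.sqrt (blockCov L 0))⁻¹ * ∑ x ∈ cube L, spinAt (x + (L : ℤ) • u) σ) ^ 2 ∂μ ≤ 4 * ε₁ := by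
  obtain ⟨θ, hθ, rfl⟩ : ∃ θ : ℝ, 0 < θ ∧ θ ^ 2 = ε₁ :=
    ⟨Real.sqrt ε₁, Real.sqrt_pos.2 hε₁, Real.sq_sqrt hε₁.le⟩
  have h1 : ∀ σ : SpinConfig (Site 3), ∑ x ∈ cube L, spinAt (x + (L : ℤ) • u) σ =
      ∑ x ∈ (cube L).image (fun x => x + (L : ℤ) • u), spinAt x σ := fun σ =>
    (Finset.sum_image (f := fun x => spinAt x σ) (injOn_add_const (cube L) ((L : ℤ) • u))).symm
  have h1' : ∀ σ : SpinConfig (Site 3), ∑ x ∈ cube L', spinAt (x + (L' : ℤ) • u) σ =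
      ∑ x ∈ (cube L').image (fun x => x + (L' : ℤ) • u), spinAt x σ := fun σ =>
    (Finset.sum_image (f := fun x => spinAt x σ) (injOn_add_const (cube L') ((L' : ℤ) • u))).symm
  simp_rw [h1, h1']
  exact increment_core hcorr _ _ (stub_blockCovAlgebra.1 L hL) (stub_blockCovAlgebra.2.1 hLL') hθ
    (integral_shiftedBlockSum_sq hcorr L u) (integral_shiftedBlockSum_sq hcorr L' u) hD

/-- `|(√V)⁻¹ Σ_{x ∈ cube L} σ_{x + Lu}| ≤ (√V)⁻¹ · #(cube L)`. [folklore] -/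
private theorem abs_normBlockSum_le (V : ℝ) (L : ℕ) (u : Site 3) (σ : SpinConfig (Site 3)) :
    |(Real.sqrt V)⁻¹ * ∑ x ∈ cube L, spinAt (x + (L : ℤ) • u) σ| ≤ (Real.sqrt V)⁻¹ * (cube L).card := by
  rw [abs_mul, abs_of_nonneg (inv_nonneg.2 (Real.sqrt_nonneg V))]
  refine mul_le_mul_of_nonneg_left ?_ (inv_nonneg.2 (Real.sqrt_nonneg V))
  calc |∑ x ∈ cube L, spinAt (x + (L : ℤ) • u) σ| ≤ ∑ x ∈ cube L, |spinAt (x + (L : ℤ) • u) σ| :=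
        Finset.abs_sum_le_sum_abs _ _
    _ = (cube L).card := by simp

/-! ## The stub -/

/-- **Stub E3 (log-continuity assembly).** Given the moment-difference inequality (stub B), the block model
(stub C) and the slab-variance bound (stub E2), every normalised block moment `R_n(·; k⃗) = critBlockMoment n · k`
is asymptotically continuous in `log L`: for every `ε > 0` there are `s > 0` and `L₀` with
`|R_n(L'; k⃗) − R_n(L; k⃗)| ≤ ε` whenever `L₀ ≤ L ≤ L' ≤ (1+s)L`. [folklore] -/
theorem stub_logContinuity :
    (∀ (Ω : Type) [MeasurableSpace Ω] (P : Measure Ω) [IsProbabilityMeasure P] (n : ℕ)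
      (Y Z : Fin n → Ω → ℝ) (M η : ℝ),
      (∀ i, Measurable (Y i)) → (∀ i, Measurable (Z i)) →
      (∀ i, ∃ B : ℝ, ∀ ω, |Y i ω| ≤ B ∧ |Z i ω| ≤ B) →
      (∀ i, ∫ ω, (Y i ω) ^ (2 * (n - 1)) ∂P ≤ M) → (∀ i, ∫ ω, (Z i ω) ^ (2 * (n - 1)) ∂P ≤ M) →
      (∀ i, ∫ ω, (Y i ω - Z i ω) ^ 2 ∂P ≤ η) →
      |(∫ ω, ∏ i, Y i ω ∂P) - ∫ ω, ∏ i, Z i ω ∂P| ≤ n * Real.sqrt η * Real.sqrt M) →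
    (∃ μ : Measure (SpinConfig (Site 3)),
      μ ∈ isingGibbsMeasures 3 (criticalBeta 3) 0 ∧ IsTranslationInvariantMeasure μ ∧ IsProbabilityMeasure μ ∧
      (∀ (n : ℕ) (y : Fin n → Site 3), criticalCorr 3 n y = ∫ σ, spinMonomial y σ ∂μ) ∧
      (∀ L : ℕ, blockCov L 0 = ∫ σ, (∑ x ∈ cube L, spinAt x σ) ^ 2 ∂μ) ∧
      (∀ (n L : ℕ) (k : Fin n → Site 3), critBlockMoment n L k =
        ∫ σ, ∏ i, ((Real.sqrt (blockCov L 0))⁻¹ * ∑ x ∈ cube L, spinAt (x + (L : ℤ) • k i) σ) ∂μ)) →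
    (∀ (k : Site 3) (ε : ℝ), 0 < ε → ∃ s : ℝ, 0 < s ∧ ∃ L₀ : ℕ, 1 ≤ L₀ ∧ ∀ L L' : ℕ, L₀ ≤ L → L ≤ L' →
      (L' : ℝ) ≤ (1 + s) * L →
      ∑ x ∈ symmDiff ((cube L').image (fun x => x + (L' : ℤ) • k)) ((cube L).image (fun x => x + (L : ℤ) • k)),
        ∑ y ∈ symmDiff ((cube L').image (fun x => x + (L' : ℤ) • k)) ((cube L).image (fun x => x + (L : ℤ) • k)),
          criticalTwoPoint 3 (y - x) ≤ ε * blockCov L 0) →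
    ∀ (n : ℕ) (k : Fin n → Site 3) (ε : ℝ), 0 < ε → ∃ s : ℝ, 0 < s ∧ ∃ L₀ : ℕ, ∀ L L' : ℕ, L₀ ≤ L → L ≤ L' →
      (L' : ℝ) ≤ (1 + s) * L → |critBlockMoment n L' k - critBlockMoment n L k| ≤ ε := by
  intro hMD hBM hSV n k ε hε
  obtain ⟨μ, -, -, hP, hcorr, -, hR⟩ := hBM
  -- Step 1: a uniform bound `M = 1 + Σᵢ |Cᵢ|` for the `2(n-1)`-th moments of the normalised block spins.
  choose C hC using fun i : Fin n => stub_blockMomentBounded (2 * (n - 1)) (fun _ : Fin (2 * (n - 1)) => k i)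
  have hM0 : 0 ≤ 1 + ∑ i, |C i| := by positivity
  have hCM : ∀ i, C i ≤ 1 + ∑ i, |C i| := fun i => by
    have h := Finset.single_le_sum (f := fun j => |C j|) (fun j _ => abs_nonneg (C j)) (Finset.mem_univ i)
    linarith [le_abs_self (C i)]
  -- Step 2: choice of `ε₁` (with `n √(4ε₁) √M ≤ ε`), then of `s` and `L₀` from the slab-variance bound.
  have hA : 0 ≤ (n : ℝ) * Real.sqrt (1 + ∑ i, |C i|) := by positivity
  obtain ⟨t, ht, hAt⟩ : ∃ t : ℝ, 0 < t ∧ (n : ℝ) * Real.sqrt (1 + ∑ i, |C i|) * t ≤ ε := by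
    refine ⟨ε / ((n : ℝ) * Real.sqrt (1 + ∑ i, |C i|) + 1), div_pos hε (by linarith), ?_⟩
    rw [mul_div_assoc', div_le_iff₀ (by linarith)]
    nlinarith
  obtain ⟨ε₁, hε₁, hε₁t⟩ : ∃ ε₁ : ℝ, 0 < ε₁ ∧ Real.sqrt (4 * ε₁) = t :=
    ⟨(t / 2) ^ 2, by positivity, by rw [show (4 : ℝ) * (t / 2) ^ 2 = t ^ 2 by ring, Real.sqrt_sq ht.le]⟩
  choose sf hsf L0f hL0f hmain using fun i : Fin n => hSV (k i) ε₁ hε₁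
  obtain ⟨s, hs, hsi⟩ : ∃ s : ℝ, 0 < s ∧ ∀ i, s ≤ sf i := by
    have hsum : 0 ≤ ∑ j, (sf j)⁻¹ := Finset.sum_nonneg fun j _ => (inv_pos.2 (hsf j)).le
    refine ⟨(1 + ∑ j, (sf j)⁻¹)⁻¹, inv_pos.2 (by linarith), fun i => inv_le_of_inv_le₀ (hsf i) ?_⟩
    have h := Finset.single_le_sum (f := fun j => (sf j)⁻¹) (fun j _ => (inv_pos.2 (hsf j)).le)
      (Finset.mem_univ i)
    linarith
  obtain ⟨L₀, hL₀, hL₀i⟩ : ∃ L₀ : ℕ, 1 ≤ L₀ ∧ ∀ i, L0f i ≤ L₀ :=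
    ⟨Finset.univ.sup L0f + 1, Nat.le_add_left 1 _,
      fun i => (Finset.le_sup (f := L0f) (Finset.mem_univ i)).trans (Nat.le_succ _)⟩
  refine ⟨s, hs, L₀, fun L L' hL hLL' hL' => ?_⟩
  have hL1 : 1 ≤ L := hL₀.trans hL
  have hL'1 : 1 ≤ L' := hL1.trans hLL'
  have hL'i : ∀ i, (L' : ℝ) ≤ (1 + sf i) * L := fun i =>
    hL'.trans (mul_le_mul_of_nonneg_right (by linarith [hsi i]) (Nat.cast_nonneg L))
  haveI := hP
  -- Step 3: the moment-difference inequality for the normalised block spins at sides `L'` and `L`.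
  have key := hMD (SpinConfig (Site 3)) μ n
    (fun i σ => (Real.sqrt (blockCov L' 0))⁻¹ * ∑ x ∈ cube L', spinAt (x + (L' : ℤ) • k i) σ)
    (fun i σ => (Real.sqrt (blockCov L 0))⁻¹ * ∑ x ∈ cube L, spinAt (x + (L : ℤ) • k i) σ)
    (1 + ∑ i, |C i|) (4 * ε₁)
    (fun i => (Finset.measurable_sum _ fun x _ => measurable_spinAt _).const_mul _)
    (fun i => (Finset.measurable_sum _ fun x _ => measurable_spinAt _).const_mul _)
    (fun i => ⟨(Real.sqrt (blockCov L' 0))⁻¹ * (cube L').card + (Real.sqrt (blockCov L 0))⁻¹ * (cube L).card,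
      fun σ => ⟨(abs_normBlockSum_le _ L' (k i) σ).trans (le_add_of_nonneg_right (by positivity)),
        (abs_normBlockSum_le _ L (k i) σ).trans (le_add_of_nonneg_left (by positivity))⟩⟩)
    (fun i => ?_) (fun i => ?_) (fun i => ?_)
  · rw [hR n L' k, hR n L k]
    refine key.trans ?_
    calc (n : ℝ) * Real.sqrt (4 * ε₁) * Real.sqrt (1 + ∑ i, |C i|)
        = (n : ℝ) * Real.sqrt (1 + ∑ i, |C i|) * t := by rw [hε₁t]; ring
      _ ≤ ε := hAt
  · -- `2(n-1)`-th moments at side `L'`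
    have h := hR (2 * (n - 1)) L' (fun _ => k i)
    simp only [Fin.prod_const] at h
    calc _ = critBlockMoment (2 * (n - 1)) L' (fun _ => k i) := h.symm
      _ ≤ _ := (le_abs_self _).trans ((hC i L' hL'1).trans (hCM i))
  · -- `2(n-1)`-th moments at side `L`
    have h := hR (2 * (n - 1)) L (fun _ => k i)
    simp only [Fin.prod_const] at h
    calc _ = critBlockMoment (2 * (n - 1)) L (fun _ => k i) := h.symm
      _ ≤ _ := (le_abs_self _).trans ((hC i L hL1).trans (hCM i))
  · -- the `L²` increments
    exact stub_logContinuity_increment hcorr hL1 hLL' (k i) hε₁ (hmain i L L' ((hL₀i i).trans hL) hLL' (hL'i i))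

end Summit.CriticalPhenomena.Ising3DConformalLimit.Cruxes.JoiningsTransfer.Sketch

end
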